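import Literature.Claims.NS.Jormakka2010
import Literature.Analysis.FluidPDE.BeltramiFlows
import Literature.Analysis.FluidPDE.ClassicalSolutionGalileanLocal
import Literature.Analysis.FluidPDE.PeriodicGalileanNonuniqueness
import Literature.Analysis.FluidPDE.TaoClassGlobal
import HarnessLib

/-!
# D-0090 NS-CLAIMS, C02 `Jormakka2010` — SALVAGE: the true steps of the skeleton, kernel-discharged

Cell ns-claims (HOME `run/shared/lean/pub/ns-claims/`), salvage seat `ns-claims-salvage-p2`, solo
lane (`Theorems/SoloSalvage<AuthorYear>.lean`, MAP-SCHEMA §1c). The typed skeleton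
`Literature/Claims/NS/Jormakka2010.lean` (J. Jormakka, EJDE 2010 No. 93; typist ns-claims-typist-2)
states the paper's steps as `def … : Prop` without asserting them. This file PROVES the steps that
are true, so that the verdict's «Steps 1–3 kernel-discharged» and the skeleton's conditional
relations become unconditional:

* `isBeltrami_initialField` — the datum `u⁰` of Lemma 2.1 (p. 2) is a strong Beltrami field,
  `curl u⁰ = −2π u⁰` (so `Δu⁰ = −(2π)²u⁰` and `e^{−(2π)²νt}u⁰` is the exact viscous decay, tree
  `isClassicalNSSolutionOn_strongBeltrami`, Majda–Bertozzi §2.3.2);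
* `isClassicalNSSolutionOn_family` — for a gauge `g` smooth on an open `U ⊇ S`, the pair (2.1)
  `(velocity ν g, pressure ν g)` is a classical unforced solution on the time set `S`: it is the
  extended-Galilean image (tree `IsClassicalNSSolutionOn.galileanBoostOn`, frame path `g(t)(1,1,1)`,
  gauge `−(3/2)(2π)² e^{−2βt}`) of the strong-Beltrami decay, since `P⁰ = −½|u⁰|² + (3/2)(2π)²`
  (`basePressure_eq`);
* **`lemma21_holds`** — Step 1 = Lemma 2.1 (p. 2) for every `ν`;
* **`theorem23Witness_holds`** — Step 2 = the proof of Theorem 2.3 (p. 4): for `c ≠ 0`, `a > 0`,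
  `(U, P)` is a classical solution on `[0, a)` with datum `u⁰`, `u`-periodic, and
  `‖U(t, x)‖ → ∞` as `t → a⁻` (the gauge `½ct²/(a−t)` is smooth on `(−∞, a)` only — this is what
  `galileanBoostOn` is for); hence `theorem23_holds` (Theorem 2.3 as printed, every `ν`) and
  **`step24Solves_holds`** (Step 3);
* `not_clayDInstance`, `not_clayDErrataInstance` — UNCONDITIONAL: at the exhibited data
  (`u⁰`, realised force `f ≡ 0`) the conclusion of Clay (D) fails in the printed AND the errata
  reading (the `g ≡ 0` member is a global smooth solution with `u` and `p` periodic), every `ν`;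
  `not_clayDelta_of_claimedTheorem` — the bridging hypothesis `ClayDelta` (Δ3 FORCE) is refuted by
  the paper's own closed-loop headline.

Theorem 2.2 (C1/C2 non-uniqueness, `Theorem22`) is discharged in the sibling
`SoloSalvageJormakka2010Thm22.lean`. The FALSE step (Step 5, `Step24UniqueLocal`) is refuter-2's
`SoloRefuteJormakka2010.lean`; nothing here touches it. Method-level lesson (barrier entry
`Literature.Barriers.NavierStokesRegularity.UnnormalisedPressureLoophole`): every object in this
file is an accelerated-frame image of ONE global smooth solution, so no statement about them can be
a statement of type (D) (`Literature.Analysis.FluidPDE.setOf_periodicSolution_infinite`,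
`exists_periodic_nonContinuable_and_global`).

WHAT THIS IS NOT: not a claim about NS regularity or blow-up; not a claim about any author beyond
the typed locator.
-/

noncomputable section

-- summit-side namespace convention `Summit.NavierStokesRegularity.NavierStokesRegularity.…` (CONVENTIONS §2)
set_option linter.dupNamespace false

open Set Function Real Filter InnerProductSpace
open scoped ContDiff Topology RealInnerProductSpace

namespace Summit.NavierStokesRegularity.NavierStokesRegularity.Theorems.Jormakka2010

open Literature.Analysis.FluidPDE Literature.Claims.NS.Jormakka2010

/-! ### The datum `u⁰` is a strong Beltrami field with `λ̄ = −2π` -/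

/-- `u⁰` on the standard basis (the skeleton's private `initialField_eq`, restated for use here).
[cite: Jormakka2010, Lemma 2.1 p.2] -/
private theorem initialField_eq' :
    initialField = fun y : EuclideanSpace ℝ (Fin 3) =>
      (2 * π * (sin (2 * π * y 1) + cos (2 * π * y 2))) • EuclideanSpace.single (0 : Fin 3) (1 : ℝ) +
      (2 * π * (sin (2 * π * y 2) + cos (2 * π * y 0))) • EuclideanSpace.single (1 : Fin 3) (1 : ℝ) +
      (2 * π * (sin (2 * π * y 0) + cos (2 * π * y 1))) • EuclideanSpace.single (2 : Fin 3) (1 : ℝ) := by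
  funext y
  ext i
  fin_cases i <;> simp [initialField]

/-- The coordinate functions are the projections. [folklore] -/
private theorem hasFDerivAt_coord' (j : Fin 3) (x : EuclideanSpace ℝ (Fin 3)) :
    HasFDerivAt (fun y : EuclideanSpace ℝ (Fin 3) => y j)
      (EuclideanSpace.proj j : EuclideanSpace ℝ (Fin 3) →L[ℝ] ℝ) x :=
  (EuclideanSpace.proj j : EuclideanSpace ℝ (Fin 3) →L[ℝ] ℝ).hasFDerivAt

/-- **`curl u⁰ = −2π u⁰`**: the datum of Lemma 2.1 is a strong Beltrami field with constant
coefficient `−2π` (it is `2π·S(abc₁₁₁(2πSx))`, `S` the swap of the last two coordinates, of the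
Arnold–Beltrami–Childress flow, Majda–Bertozzi Example 2.8). Direct computation of the Jacobian.
[cite: Jormakka2010, Lemma 2.1 p.2] -/
theorem isBeltrami_initialField : IsBeltrami initialField (fun _ => -(2 * π)) := by
  intro x
  have h0 := (((((hasFDerivAt_coord' 1 x).const_mul (2 * π)).sin).add
    (((hasFDerivAt_coord' 2 x).const_mul (2 * π)).cos)).const_mul (2 * π)).smul_const
    (EuclideanSpace.single (0 : Fin 3) (1 : ℝ))
  have h1 := (((((hasFDerivAt_coord' 2 x).const_mul (2 * π)).sin).add
    (((hasFDerivAt_coord' 0 x).const_mul (2 * π)).cos)).const_mul (2 * π)).smul_const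
    (EuclideanSpace.single (1 : Fin 3) (1 : ℝ))
  have h2 := (((((hasFDerivAt_coord' 0 x).const_mul (2 * π)).sin).add
    (((hasFDerivAt_coord' 1 x).const_mul (2 * π)).cos)).const_mul (2 * π)).smul_const
    (EuclideanSpace.single (2 : Fin 3) (1 : ℝ))
  have h : HasFDerivAt (fun y : EuclideanSpace ℝ (Fin 3) =>
      (2 * π * (sin (2 * π * y 1) + cos (2 * π * y 2))) • EuclideanSpace.single (0 : Fin 3) (1 : ℝ) +
      (2 * π * (sin (2 * π * y 2) + cos (2 * π * y 0))) • EuclideanSpace.single (1 : Fin 3) (1 : ℝ) +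
      (2 * π * (sin (2 * π * y 0) + cos (2 * π * y 1))) • EuclideanSpace.single (2 : Fin 3) (1 : ℝ))
      _ x :=
    (h0.add h1).add h2
  rw [curl_eq_curlCLM, initialField_eq', h.fderiv, curlCLM_apply]
  ext i
  fin_cases i <;> simp <;> ring

/-- `div u⁰ = 0` in the tree's `VectorCalculus` vocabulary (definitionally the skeleton's
`isDivFree_initialField`). [cite: Jormakka2010, Lemma 2.1 (proof) p.2] -/
theorem isDivFree_initialField' : VectorCalculus.IsDivFree initialField :=
  fun x => isDivFree_initialField x

/-- **`P⁰ = −½|u⁰|² + (3/2)(2π)²`**: the pressure factor of (2.1) is the Bernoulli pressure of the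
Beltrami field up to a constant (`sin² + cos² = 1` three times). [cite: Jormakka2010, Lemma 2.1 eq. (2.1) p.2] -/
theorem basePressure_eq (z : EuclideanSpace ℝ (Fin 3)) :
    basePressure z = -(‖initialField z‖ ^ 2 / 2) + 3 / 2 * (2 * π) ^ 2 := by
  have c0 : initialField z 0 = 2 * π * (sin (2 * π * z 1) + cos (2 * π * z 2)) := by
    simp [initialField]
  have c1 : initialField z 1 = 2 * π * (sin (2 * π * z 2) + cos (2 * π * z 0)) := by
    simp [initialField]
  have c2 : initialField z 2 = 2 * π * (sin (2 * π * z 0) + cos (2 * π * z 1)) := by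
    simp [initialField]
  rw [EuclideanSpace.real_norm_sq_eq, Fin.sum_univ_three, c0, c1, c2]
  simp only [basePressure]
  have h0 := sin_sq_add_cos_sq (2 * π * z 0)
  have h1 := sin_sq_add_cos_sq (2 * π * z 1)
  have h2 := sin_sq_add_cos_sq (2 * π * z 2)
  linear_combination ((2 * π) ^ 2 / 2) * (h0 + h1 + h2)

/-- `⟪(1,1,1), y⟫ = y₁ + y₂ + y₃`. [folklore] -/
private theorem inner_ones (y : EuclideanSpace ℝ (Fin 3)) : ⟪ones, y⟫ = y 0 + y 1 + y 2 := by
  simp [ones, PiLp.inner_apply, Fin.sum_univ_three]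

/-- `(1,1,1) ≠ 0`. [folklore] -/
private theorem ones_ne_zero : ones ≠ 0 := by
  intro h
  have := congrArg (fun v : EuclideanSpace ℝ (Fin 3) => v 0) h
  simp [ones] at this

/-! ### The family (2.1) is the extended-Galilean image of the strong-Beltrami decay -/

/-- The gauge function making the boosted Bernoulli pressure equal to the printed `P`:
`γ(t) = −(3/2)(2π)² e^{−2(2π)²νt}` is smooth. [folklore] -/
private theorem contDiff_gauge (ν : ℝ) :
    ContDiff ℝ ∞ (fun s : ℝ => -(3 / 2 * (2 * π) ^ 2 * exp (-(2 * ((2 * π) ^ 2 * ν * s))))) := by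
  have h : ContDiff ℝ ∞ (fun s : ℝ => -(2 * ((2 * π) ^ 2 * ν * s))) :=
    (contDiff_const.mul ((contDiff_const.mul contDiff_id))).neg
  exact (contDiff_const.mul h.exp).neg

/-- **The family (2.1) solves the unforced system on any time set `S` of unique differentiability
on a neighbourhood `U` of which the gauge `g` is smooth.** Mechanism (Lemma 2.1 is by "direct
substitution" in print): `velocity ν g`, `pressure ν g` are, slice by slice on `S`, the
extended-Galilean image with frame path `g(t)(1,1,1)` and pressure gauge `−(3/2)(2π)²e^{−2βt}` of
the exact strong-Beltrami decay `e^{−(2π)²νt}u⁰`, `−½e^{−2(2π)²νt}|u⁰|²` (tree: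
`isClassicalNSSolutionOn_strongBeltrami`, `IsClassicalNSSolutionOn.galileanBoostOn`,
`IsClassicalNSSolutionOn.congr_slices`). [cite: Jormakka2010, Lemma 2.1 p.2] -/
theorem isClassicalNSSolutionOn_family {S U : Set ℝ} (hS : UniqueDiffOn ℝ S) (hU : IsOpen U)
    (hSU : S ⊆ U) (ν : ℝ) {g : ℝ → ℝ} (hg : ContDiffOn ℝ ∞ g U) :
    IsClassicalNSSolutionOn S ν 0 (velocity ν g) (pressure ν g) := by
  -- the base solution and its boost
  have hB := (isClassicalNSSolutionOn_strongBeltrami ν isBeltrami_initialField contDiff_initialField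
    isDivFree_initialField').mono (subset_univ S) hS
  have hξ : ContDiffOn ℝ ∞ (fun s => g s • ones) U := hg.smul contDiffOn_const
  have hb := hB.galileanBoostOn hS hU hSU hξ (contDiff_gauge ν).contDiffOn
  -- derivatives of the frame path on `U`
  have hgd : ∀ t ∈ U, DifferentiableAt ℝ g t := fun t ht =>
    (hg.differentiableOn (by simp) t ht).differentiableAt (hU.mem_nhds ht)
  have hg' : ContDiffOn ℝ ∞ (deriv g) U := ((contDiffOn_infty_iff_deriv_of_isOpen hU).1 hg).2
  have hgd' : ∀ t ∈ U, DifferentiableAt ℝ (deriv g) t := fun t ht =>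
    (hg'.differentiableOn (by simp) t ht).differentiableAt (hU.mem_nhds ht)
  have hd1 : ∀ t ∈ U, deriv (fun s => g s • ones) t = deriv g t • ones := fun t ht =>
    deriv_smul_const (hgd t ht) ones
  have hd2 : ∀ t ∈ U, deriv (deriv (fun s => g s • ones)) t = deriv (deriv g) t • ones := by
    intro t ht
    have hev : deriv (fun s => g s • ones) =ᶠ[𝓝 t] fun s => deriv g s • ones := by
      filter_upwards [hU.mem_nhds ht] with s hs
      exact hd1 s hs
    rw [hev.deriv_eq]
    exact deriv_smul_const (hgd' t ht) ones
  -- the exponential factors agree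
  have he1 : ∀ t : ℝ, exp (-((-(2 * π)) ^ 2 * ν) * t) = exp (-((2 * π) ^ 2 * ν * t)) := fun t =>
    congrArg exp (by ring)
  have he2 : ∀ t : ℝ, exp (-(2 * ((-(2 * π)) ^ 2 * ν)) * t) = exp (-(2 * ((2 * π) ^ 2 * ν * t))) :=
    fun t => congrArg exp (by ring)
  refine hb.congr_slices (fun t ht => ?_) (fun t ht => ?_)
  · funext y
    simp only [velocity, strongBeltramiVelocity_apply, hd1 t (hSU ht), he1]
  · funext y
    simp only [pressure, strongBeltramiPressure, hd2 t (hSU ht), he2, basePressure_eq,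
      real_inner_smul_left, inner_ones]
    ring

/-! ### Step 1: Lemma 2.1 -/

/-- At `t = 0` the family (2.1) has datum `u⁰` whenever `g(0) = g′(0) = 0`.
[cite: Jormakka2010, Lemma 2.1 p.2] -/
theorem velocity_zero (ν : ℝ) {g : ℝ → ℝ} (hg0 : g 0 = 0) (hg'0 : deriv g 0 = 0) :
    velocity ν g 0 = initialField := by
  funext x
  simp [velocity, hg0, hg'0]

/-- **Step 1 (Lemma 2.1, p. 2) holds, for every viscosity `ν`**: `u⁰` is smooth, periodic and
divergence free, and for every smooth `g` with `g(0) = g′(0) = 0` the pair (2.1) is smooth on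
`ℝ³ × [0,∞)` and solves (1.1)–(1.3) with `f ≡ 0` and datum `u⁰`. [cite: Jormakka2010, Lemma 2.1 p.2] -/
theorem lemma21_holds (ν : ℝ) : Lemma21 ν := by
  refine ⟨isPeriodicDatum_initialField, fun g hg hg0 hg'0 => ?_⟩
  have hcl := isClassicalNSSolutionOn_family (uniqueDiffOn_Ici 0) isOpen_univ (subset_univ _) ν
    hg.contDiffOn
  obtain ⟨hns, hu, hp⟩ := isNavierStokesSolution_and_smooth_iff.2 ⟨hcl, velocity_zero ν hg0 hg'0⟩
  exact ⟨hu, hp, hns⟩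

/-- **Clay (D)'s conclusion FAILS at the exhibited data**, unconditionally: for every `ν`, the
datum `u⁰` with the realised force `f ≡ 0` HAS a global smooth `u`-periodic solution (the `g ≡ 0`
member of (2.1); printed reading of (D)). [cite: Jormakka2010, Theorem 2.2 (proof) p.3] -/
theorem not_clayDInstance (ν : ℝ) : ¬ ClayDInstance ν :=
  not_clayDInstance_of_lemma21 (lemma21_holds ν)

/-- The same in the CMI-errata reading (`u` and `p` periodic): unconditional.
[cite: Jormakka2010, Theorem 2.2 (proof) p.3] -/
theorem not_clayDErrataInstance (ν : ℝ) : ¬ ClayDErrataInstance ν :=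
  not_clayDErrataInstance_of_lemma21 (lemma21_holds ν)

/-- **The bridging hypothesis `ClayDelta` (axis Δ3 FORCE) contradicts the paper's own headline**:
`ClaimedTheorem → ¬ ClayDelta`, now unconditional in Lemma 2.1. [cite: Jormakka2010, Theorem 2.4 p.4 and §4 p.13] -/
theorem not_clayDelta_of_claimedTheorem (hC : ClaimedTheorem) : ¬ ClayDelta :=
  not_clayDelta_of_lemma21 (fun ν _ => lemma21_holds ν) hC

/-! ### Step 2: the witness of Theorem 2.3 (gauge `g(t) = ½ct²/(a − t)`) -/

/-- The gauge of Theorem 2.3 is smooth on `(−∞, a)`. [cite: Jormakka2010, Theorem 2.3 (proof) p.4] -/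
theorem contDiffOn_blowupGauge (c a : ℝ) : ContDiffOn ℝ ∞ (blowupGauge c a) (Iio a) := by
  have h : ContDiffOn ℝ ∞ (fun t : ℝ => c * t ^ 2 / (2 * (a - t))) (Iio a) :=
    (contDiffOn_const.mul (contDiffOn_id.pow 2)).div
      (contDiffOn_const.mul (contDiffOn_const.sub contDiffOn_id))
      fun t ht => mul_ne_zero two_ne_zero (sub_ne_zero.2 (ne_of_gt ht))
  exact h

/-- Derivative of the gauge away from `t = a` (quotient rule):
`g′(t) = (2ct·2(a−t) − ct²·(−2)) / (2(a−t))²` (`= ct(2a−t)/(2(a−t)²)`).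
[cite: Jormakka2010, Theorem 2.3 (proof) p.4] -/
theorem hasDerivAt_blowupGauge (c a : ℝ) {t : ℝ} (ht : t ≠ a) :
    HasDerivAt (blowupGauge c a)
      ((c * (2 * t) * (2 * (a - t)) - c * t ^ 2 * (2 * (-1))) / (2 * (a - t)) ^ 2) t := by
  have hnum : HasDerivAt (fun s : ℝ => c * s ^ 2) (c * (2 * t)) t := by
    simpa using (hasDerivAt_pow 2 t).const_mul c
  have hden : HasDerivAt (fun s : ℝ => 2 * (a - s)) (2 * (-1)) t :=
    ((hasDerivAt_id' t).const_sub a).const_mul 2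
  have h := hnum.div hden (mul_ne_zero two_ne_zero (sub_ne_zero.2 (Ne.symm ht)))
  exact h

/-- `g(0) = 0`. [cite: Jormakka2010, Theorem 2.3 (proof) p.4] -/
theorem blowupGauge_zero (c a : ℝ) : blowupGauge c a 0 = 0 := by
  simp [blowupGauge]

/-- `g′(0) = 0` (`a ≠ 0`). [cite: Jormakka2010, Theorem 2.3 (proof) p.4] -/
theorem deriv_blowupGauge_zero (c : ℝ) {a : ℝ} (ha : a ≠ 0) : deriv (blowupGauge c a) 0 = 0 := by
  rw [(hasDerivAt_blowupGauge c a (Ne.symm ha)).deriv]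
  simp

/-- **Lower bound for the frame speed near `t = a`**: for `t ∈ [a/2, a)`,
`|g′(t)| ≥ |c| a² / 4 · (a − t)⁻²` (since `t(2a − t) ≥ a²/2·…`; exact value
`|c| t(2a−t) / (2(a−t)²)`). [cite: Jormakka2010, Theorem 2.3 (proof) p.4] -/
theorem abs_deriv_blowupGauge_ge {c a t : ℝ} (ha : 0 < a) (ht : t ∈ Ico (a / 2) a) :
    |c| * a ^ 2 / 4 * (1 / (a - t)) ^ 2 ≤ |deriv (blowupGauge c a) t| := by
  have hta : t ≠ a := ne_of_lt ht.2
  have hat : 0 < a - t := sub_pos.2 ht.2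
  rw [(hasDerivAt_blowupGauge c a hta).deriv]
  have e : (c * (2 * t) * (2 * (a - t)) - c * t ^ 2 * (2 * (-1))) / (2 * (a - t)) ^ 2 =
      c * (t * (2 * a - t) / (2 * (a - t) ^ 2)) := by
    field_simp
    ring
  rw [e, abs_mul]
  have hpos : 0 ≤ t * (2 * a - t) / (2 * (a - t) ^ 2) := by
    have h1 : 0 ≤ t := le_trans (by positivity) ht.1
    have h2 : 0 ≤ 2 * a - t := by linarith [ht.2]
    positivity
  rw [abs_of_nonneg hpos]
  have key : a ^ 2 / 4 * (1 / (a - t)) ^ 2 ≤ t * (2 * a - t) / (2 * (a - t) ^ 2) := by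
    rw [div_pow, one_pow, ← div_div, show a ^ 2 / 4 * (1 / (a - t) ^ 2) =
      (a ^ 2 / 4) / (a - t) ^ 2 by ring, show t * (2 * a - t) / 2 / (a - t) ^ 2 =
      (t * (2 * a - t) / 2) / (a - t) ^ 2 by ring]
    apply div_le_div_of_nonneg_right _ (by positivity)
    nlinarith [ht.1, ht.2]
  calc |c| * a ^ 2 / 4 * (1 / (a - t)) ^ 2 = |c| * (a ^ 2 / 4 * (1 / (a - t)) ^ 2) := by ring
    _ ≤ |c| * (t * (2 * a - t) / (2 * (a - t) ^ 2)) :=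
      mul_le_mul_of_nonneg_left key (abs_nonneg c)

/-- `1/(a − t) → +∞` as `t → a⁻`. [folklore] -/
private theorem tendsto_inv_sub (a : ℝ) : Tendsto (fun t : ℝ => 1 / (a - t)) (𝓝[<] a) atTop := by
  have h1 : Tendsto (fun t : ℝ => a - t) (𝓝[<] a) (𝓝[>] 0) := by
    refine tendsto_nhdsWithin_of_tendsto_nhds_of_eventually_within _ ?_ ?_
    · have : Tendsto (fun t : ℝ => a - t) (𝓝 a) (𝓝 (a - a)) :=
        (continuous_const.sub continuous_id).tendsto a
      rw [sub_self] at this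
      exact this.mono_left nhdsWithin_le_nhds
    · filter_upwards [self_mem_nhdsWithin] with t ht
      have ht' : t < a := ht
      exact sub_pos.2 ht'
  simpa [one_div, Function.comp_def] using tendsto_inv_nhdsGT_zero.comp h1

/-- **"`g′(t)` becomes infinite at `t = a` … `u₁ = U₁` becomes infinite when `t` approaches `a`"**
(p. 4, p. 5 l. 4–5): for `c ≠ 0`, `a > 0` and every `x`, `‖U(t, x)‖ → ∞` as `t → a⁻`
(`‖U‖ ≥ ‖(1,1,1)‖·|g′(t)| − e^{|β|a}·sup|u⁰|`). [cite: Jormakka2010, Theorem 2.3 (proof) p.4] -/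
theorem tendsto_norm_blowupVelocity (ν : ℝ) {c a : ℝ} (hc : c ≠ 0) (ha : 0 < a)
    (x : EuclideanSpace ℝ (Fin 3)) :
    Tendsto (fun t => ‖blowupVelocity ν c a t x‖) (𝓝[<] a) atTop := by
  obtain ⟨C₀, hC₀⟩ := isLatticePeriodic_initialField.exists_forall_norm_le
    (contDiff_initialField (n := ∞)).continuous
  set K : ℝ := exp (|(2 * π) ^ 2 * ν| * a) * C₀ with hK
  have hone : 0 < ‖ones‖ := norm_pos_iff.2 ones_ne_zero
  -- the comparison function tends to `∞`
  have hG : Tendsto (fun t => ‖ones‖ * (|c| * a ^ 2 / 4 * (1 / (a - t)) ^ 2) - K) (𝓝[<] a) atTop := by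
    refine tendsto_atTop_add_const_right _ (-K) (Tendsto.const_mul_atTop hone ?_)
    refine Tendsto.const_mul_atTop (by positivity : 0 < |c| * a ^ 2 / 4) ?_
    exact (tendsto_pow_atTop two_ne_zero).comp (tendsto_inv_sub a)
  refine tendsto_atTop_mono' (𝓝[<] a) ?_ hG
  filter_upwards [Ico_mem_nhdsLT (half_lt_self ha)] with t ht
  have ht0 : 0 ≤ t := le_trans (by positivity) ht.1
  -- `‖U‖ ≥ ‖g′ • 1‖ − ‖e^{−βt} u⁰(…)‖`
  have hA : ‖exp (-((2 * π) ^ 2 * ν * t)) • initialField (x + blowupGauge c a t • ones)‖ ≤ K := by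
    rw [norm_smul, Real.norm_eq_abs, abs_of_pos (exp_pos _), hK]
    refine mul_le_mul (exp_le_exp.2 ?_) (hC₀ _) (norm_nonneg _) (exp_pos _).le
    calc -((2 * π) ^ 2 * ν * t) ≤ |(2 * π) ^ 2 * ν * t| := neg_le_abs _
      _ = |(2 * π) ^ 2 * ν| * t := by rw [abs_mul, abs_of_nonneg ht0]
      _ ≤ |(2 * π) ^ 2 * ν| * a := mul_le_mul_of_nonneg_left ht.2.le (abs_nonneg _)
  have hB : ‖deriv (blowupGauge c a) t • ones‖ = ‖ones‖ * |deriv (blowupGauge c a) t| := by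
    rw [norm_smul, Real.norm_eq_abs, mul_comm]
  have hlow : ‖deriv (blowupGauge c a) t • ones‖ -
      ‖exp (-((2 * π) ^ 2 * ν * t)) • initialField (x + blowupGauge c a t • ones)‖ ≤
      ‖blowupVelocity ν c a t x‖ := by
    have := norm_sub_norm_le (deriv (blowupGauge c a) t • ones)
      (exp (-((2 * π) ^ 2 * ν * t)) • initialField (x + blowupGauge c a t • ones))
    rw [norm_sub_rev] at this
    simpa [blowupVelocity, velocity] using this
  have hg := abs_deriv_blowupGauge_ge (c := c) ha ht
  calc ‖ones‖ * (|c| * a ^ 2 / 4 * (1 / (a - t)) ^ 2) - K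
      ≤ ‖ones‖ * |deriv (blowupGauge c a) t| - K := by
        gcongr
    _ ≤ ‖deriv (blowupGauge c a) t • ones‖ -
        ‖exp (-((2 * π) ^ 2 * ν * t)) • initialField (x + blowupGauge c a t • ones)‖ := by
        rw [hB]; linarith [hA]
    _ ≤ ‖blowupVelocity ν c a t x‖ := hlow

/-- **Step 2 (the witness of the proof of Theorem 2.3, p. 4) holds** for `c ≠ 0`, `a > 0`, every
`ν`: `(U, P)` is a classical unforced solution on `ℝ³ × [0, a)` with `U(0) = u⁰`, `U(·,t)`
periodic, and `‖U(t,x)‖ → ∞` as `t → a⁻`. [cite: Jormakka2010, Theorem 2.3 (proof) p.4] -/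
theorem theorem23Witness_holds (ν : ℝ) {c a : ℝ} (hc : c ≠ 0) (ha : 0 < a) :
    Theorem23Witness ν c a := by
  refine ⟨?_, ?_, fun t _ => isLatticePeriodic_velocity ν _ t,
    fun x => tendsto_norm_blowupVelocity ν hc ha x⟩
  · exact isClassicalNSSolutionOn_family (uniqueDiffOn_Ico 0 a) isOpen_Iio (fun t ht => ht.2) ν
      (contDiffOn_blowupGauge c a)
  · exact velocity_zero ν (blowupGauge_zero c a) (deriv_blowupGauge_zero c ha.ne')

/-- **Theorem 2.3 as printed (pp. 3–4) holds, for every `ν`** (data `u⁰`, `f ≡ 0`; `c = 1`,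
`a = 2`): there is a smooth periodic solution on `[0, a)` that cannot be smoothly continued to
`[0,∞)`. By `exists_periodic_nonContinuable_and_global` the same shape holds even at ZERO datum;
it is an ∃-statement about one representative, not Clay (D). [cite: Jormakka2010, Theorem 2.3 pp.3–4] -/
theorem theorem23_holds (ν : ℝ) : Theorem23 ν :=
  theorem23_of_witness two_pos isPeriodicDatum_initialField
    (theorem23Witness_holds ν one_ne_zero two_pos)

/-- **Step 3 (proof of Theorem 2.4, p. 4: "There is a solution `u = U` to this equation") holds**
for `c ≠ 0`, `a > 0`, every `ν`. [cite: Jormakka2010, Theorem 2.4 (proof) p.4] -/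
theorem step24Solves_holds (ν : ℝ) {c a : ℝ} (hc : c ≠ 0) (ha : 0 < a) : Step24Solves ν c a :=
  step24Solves_of_witness (theorem23Witness_holds ν hc ha)

end Summit.NavierStokesRegularity.NavierStokesRegularity.Theorems.Jormakka2010

end

-- WHAT THIS IS NOT: not a claim about NS regularity or blow-up; not a claim about any author beyond the
-- typed locator.
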